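import Literature.Computability.AlgebraicComplexity.MS21ANFHasseStructure
import HarnessLib

/-!
# The ANF structure lemma in the `hstruct` binder shape of `MS2021_thm_35_of_h512_hstruct`
# (B36, stage S5; cell `val-lit`, seat t18 g5)

Theorem-only file (no definitions, no facts, D-0026). `MS21ANFHasseStructure` proves the
characteristic-free replacement of [MediniShpilka2021, Lemma 5.13 (arXiv:2102.05632 p0029:L3-L26)]
with the mixed hypothesis written as `Δ¹_{col_j N} Δ¹_{col_j' N} ANF_Δ = 0`; seat x5 g3's assembly
`MS2021_thm_35_of_h512_hstruct` (`MS21ANFThm35OfStructureLemma`) spells the same hypothesis as the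
double sum `Σ_a Σ_a' N_{aj} N_{a'j'} ∂_a∂_a' ANF_Δ = 0`. `MS2021.hasseD_one_hasseD_one_eq_sum` identifies
the two and `MS2021.anf_hstruct` is the `hstruct` binder VERBATIM, so that (x5's registry claim)
`MS2021_thm_35_of_h512_hstruct anf_h512 anf_hstruct : MS2021_thm_35` (with seat p1 g5's `anf_h512`,
`MS21ANFMonomialInclusion`).

HONEST FRAMING: a characteristic-free form of one lemma of a 2021 paper; `VP ≠ VNP` is NOT proved and
nothing here bears on it.

## References
* [MediniShpilka2021] D. Medini, A. Shpilka, CCC 2021 (LIPIcs 200:19) = arXiv:2102.05632: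
  Lemma 5.13 (p0029:L3-L26), Thm 35.
-/

noncomputable section

open MvPolynomial

namespace Literature.Computability.AlgebraicComplexity

namespace MS2021

variable {K : Type*} [Field K]

/-- `Δ¹_u Δ¹_v f = Σ_a Σ_a' u_a v_a' ∂_a ∂_a' f`. [cite: MediniShpilka2021, Def 3.6 (arXiv p0017:L44-L49)] -/
theorem hasseD_one_hasseD_one_eq_sum {σ : Type*} [Fintype σ] (u v : σ → K)
    (f : MvPolynomial σ K) :
    hasseD 1 u (hasseD 1 v f) = ∑ a, ∑ a', C (u a * v a') * pderiv a (pderiv a' f) := by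
  classical
  rw [hasseD_one, hasseD_one]
  refine Finset.sum_congr rfl fun a _ => ?_
  rw [map_sum, Finset.mul_sum]
  refine Finset.sum_congr rfl fun a' _ => ?_
  rw [pderiv_C_mul, ← mul_assoc, ← C_mul]

/-- **`hstruct`** — the ANF structure lemma in the binder shape of
`MS2021_thm_35_of_h512_hstruct`: for invertible `N`, if `Δ²_{col_j N} ANF_Δ = 0` for all `j` and
`Σ_a Σ_a' N_{aj} N_{a'j'} ∂_a∂_a' ANF_Δ = 0` for all `+`-pairs `(j, j')`, then
`mon(ANF_Δ(Ny)) ⊆ mon(ANF_Δ)` — every field, every `Δ`.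
[cite: MediniShpilka2021, Lemma 5.13 (arXiv p0029:L3-L26), characteristic-free replacement] -/
theorem anf_hstruct (K : Type*) [Field K] (Δ : ℕ) (N : Matrix (Fin (4 ^ Δ)) (Fin (4 ^ Δ)) K)
    (hN : IsUnit N.det) (h2 : ∀ j, hasseD 2 (fun a => N a j) (anf K Δ) = 0)
    (h11 : ∀ j j', pderiv j (pderiv j' (anf K Δ)) = 0 →
      (∑ a, ∑ a', C (N a j * N a' j') * pderiv a (pderiv a' (anf K Δ))) = 0) :
    (affSubst le_rfl N 0 (anf K Δ)).support ⊆ (anf K Δ).support :=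
  support_affSubst_anf_subset_of_cols Δ N hN h2 fun j j' h => by
    rw [hasseD_one_hasseD_one_eq_sum]; exact h11 j j' h

end MS2021

end Literature.Computability.AlgebraicComplexity
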